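import Mathlib.NumberTheory.LSeries.RiemannZeta
import Mathlib.Analysis.SpecialFunctions.Gamma.Beta
import Mathlib.Analysis.SpecialFunctions.Gamma.Deligne
import Literature.NumberTheory.LFunctions.RiemannXi
import Literature.NumberTheory.LFunctions.RiemannSiegelPhase
import HarnessLib

/-!
# `ξ` on the critical line in terms of `ζ`: the reflection bookkeeping for Conrey–Li 2000

Support file for the discharge of the barrier `Literature.Barriers.RiemannHypothesis.DeBrangesPositivity`
(`DeBrangesPositivity.lean`; Conrey–Li 2000, §3.1 (3.2), (3.4)). Both printed failures are
statements about `ξ(s) = ½ s(s−1) π^{-s/2} Γ(s/2) ζ(s)` (`Literature.NumberTheory.LFunctions.riemannXi`)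
at points `s`, `s + 1` with `Re s = ½`; the certified `ζ`-numerics of the tree
(`Literature/NumberTheory/LFunctions/ZetaArgumentCertificate.lean`) know `ζ` and `ζ'` but not `Γ`.
The `Γ`-factors are removed exactly, by the reflection formula: for `Re s = ½` one has
`conj (s + 1) = 2 − s`, hence (Deligne's `Γ_ℝ(s) = π^{-s/2} Γ(s/2)`)

  `Γ_ℝ(s) · conj Γ_ℝ(s+1) = Γ_ℝ(s) Γ_ℝ(2−s) = π⁻¹ Γ(s/2) Γ(1 − s/2) = 1 / sin(πs/2)`,

and `sin(π(½+it)/2) = (√2/2) cosh(πt/2) · (1 + i tanh(πt/2))`. So, up to a positive real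
factor, `Γ_ℝ(½+it) conj Γ_ℝ(3/2+it)` is `1 − i tanh(πt/2)`, with `tanh(πt/2)` within `2/(1+πt/2)²`
of `1`.

## Main results (namespace `Literature.Barriers.RiemannHypothesis`, all proved)

* `riemannXi_eq_Gammaℝ_mul_zeta` — `ξ(s) = s(s−1)/2 · Γ_ℝ(s) ζ(s)` for `Re s > 0`, `s ≠ 1`.
* `Gammaℝ_mul_Gammaℝ_two_sub` — `Γ_ℝ(s) Γ_ℝ(2 − s) = 1 / sin(πs/2)` (all `s`).
* `sin_pi_mul_half_critical` — `sin(π(½+it)/2) = (√2/2) cosh(πt/2) (1 + i tanh(πt/2))`.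
* `Gammaℝ_mul_conj_Gammaℝ_succ_critical` — `∃ c > 0, Γ_ℝ(½+it) conj Γ_ℝ(½+it+1) = c (1 − i tanh(πt/2))`.
* `one_sub_tanh_le` — `0 ≤ x → 1 − tanh x ≤ 2/(1+x)²`.
* `re_div_neg_iff` — `(z/w).re < 0 ↔ (z conj w).re < 0` for `w ≠ 0`.

## References

* [ConreyLi2000] J. B. Conrey, X.-J. Li, IMRN 2000:18, 929–940, §3.1.
* [Titchmarsh1986] E. C. Titchmarsh, *The Theory of the Riemann Zeta-Function*, §2.1 (`ξ`, `Γ`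
  reflection and duplication in the functional equation).
-/

noncomputable section

open Complex Literature.NumberTheory.LFunctions
open scoped Real ComplexConjugate

namespace Literature.Barriers.RiemannHypothesis

/-- `ξ(s) = ½ s(s−1) Γ_ℝ(s) ζ(s)` on `Re s > 0`, `s ≠ 1` (`Λ = Γ_ℝ ζ` there, Mathlib
`riemannZeta_def_of_ne_zero`; Titchmarsh §2.1 (2.1.12)). [cite: Titchmarsh1986, §2.1] -/
theorem riemannXi_eq_Gammaℝ_mul_zeta {s : ℂ} (hs : 0 < s.re) (hs1 : s ≠ 1) :
    riemannXi s = s * (s - 1) / 2 * (Gammaℝ s * riemannZeta s) := by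
  have h0 : s ≠ 0 := fun h ↦ by simp [h] at hs
  have hG : Gammaℝ s ≠ 0 := Gammaℝ_ne_zero_of_re_pos hs
  have hΛ : completedRiemannZeta s = Gammaℝ s * riemannZeta s := by
    rw [riemannZeta_def_of_ne_zero h0, mul_div_cancel₀ _ hG]
  rw [riemannXi_eq_mul_completedRiemannZeta h0 hs1, hΛ]

/-- **Reflection for `Γ_ℝ`**: `Γ_ℝ(s) Γ_ℝ(2 − s) = 1 / sin(πs/2)` for every `s`
(`π^{-s/2} π^{-(2-s)/2} = π⁻¹` and `Γ(s/2)Γ(1 − s/2) = π / sin(πs/2)`, Mathlib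
`Complex.Gamma_mul_Gamma_one_sub`). [cite: Titchmarsh1986, §2.1] -/
theorem Gammaℝ_mul_Gammaℝ_two_sub (s : ℂ) :
    Gammaℝ s * Gammaℝ (2 - s) = 1 / Complex.sin (π * s / 2) := by
  have hπ : (π : ℂ) ≠ 0 := ofReal_ne_zero.mpr Real.pi_ne_zero
  rw [Gammaℝ_def, Gammaℝ_def]
  have hpow : (π : ℂ) ^ (-s / 2) * (π : ℂ) ^ (-(2 - s) / 2) = (π : ℂ)⁻¹ := by
    rw [← cpow_add _ _ hπ, show -s / 2 + -(2 - s) / 2 = (-1 : ℂ) by ring, cpow_neg_one]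
  have hrefl := Complex.Gamma_mul_Gamma_one_sub (s / 2)
  calc (π : ℂ) ^ (-s / 2) * Gamma (s / 2) * ((π : ℂ) ^ (-(2 - s) / 2) * Gamma ((2 - s) / 2))
      = ((π : ℂ) ^ (-s / 2) * (π : ℂ) ^ (-(2 - s) / 2)) * (Gamma (s / 2) * Gamma (1 - s / 2)) := by
        rw [show (2 - s) / 2 = 1 - s / 2 by ring]; ring
    _ = (π : ℂ)⁻¹ * (π / Complex.sin (π * (s / 2))) := by rw [hpow, hrefl]
    _ = 1 / Complex.sin (π * s / 2) := by
        rw [show (π : ℂ) * (s / 2) = π * s / 2 by ring]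
        field_simp

/-- `sin(π(½ + it)/2) = (√2/2)·cosh(πt/2)·(1 + i tanh(πt/2))` (`sin(x+iy) = sin x cosh y +
i cos x sinh y` with `x = π/4`). [folklore] -/
theorem sin_pi_mul_half_critical (t : ℝ) :
    Complex.sin (π * (1 / 2 + t * I) / 2) =
      ((Real.sqrt 2 / 2 * Real.cosh (π * t / 2) : ℝ) : ℂ) * (1 + Real.tanh (π * t / 2) * I) := by
  have hc : Real.cosh (π * t / 2) ≠ 0 := (Real.cosh_pos _).ne'
  have e1 : (π : ℂ) * (1 / 2 + t * I) / 2 = ((π / 4 : ℝ) : ℂ) + ((π * t / 2 : ℝ) : ℂ) * I := by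
    push_cast; ring
  rw [e1, Complex.sin_add_mul_I, ← ofReal_sin, ← ofReal_cos, ← ofReal_cosh, ← ofReal_sinh,
    Real.sin_pi_div_four, Real.cos_pi_div_four, Real.tanh_eq_sinh_div_cosh]
  generalize Real.cosh (π * t / 2) = a at hc ⊢
  generalize Real.sinh (π * t / 2) = b
  have hc' : (a : ℂ) ≠ 0 := ofReal_ne_zero.mpr hc
  push_cast
  field_simp

/-- The factor in `sin_pi_mul_half_critical` is positive. [folklore] -/
theorem sqrt_two_div_two_mul_cosh_pos (t : ℝ) : 0 < Real.sqrt 2 / 2 * Real.cosh (π * t / 2) :=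
  mul_pos (by positivity) (Real.cosh_pos _)

/-- **`Γ_ℝ(½+it) · conj Γ_ℝ(½+it+1) = c · (1 − i tanh(πt/2))` with `c > 0`** (namely
`c = 1 / ((√2/2) cosh(πt/2) (1 + tanh²(πt/2)))`): on the critical line `conj(s+1) = 2 − s`, so the
left side is `Γ_ℝ(s)Γ_ℝ(2−s) = 1/sin(πs/2)` (`Gammaℝ_mul_Gammaℝ_two_sub`, `Gammaℝ_conj`).
[cite: Titchmarsh1986, §2.1] -/
theorem Gammaℝ_mul_conj_Gammaℝ_succ_critical (t : ℝ) :
    ∃ c : ℝ, 0 < c ∧ Gammaℝ (1 / 2 + t * I) * conj (Gammaℝ (1 / 2 + t * I + 1)) =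
      (c : ℂ) * (1 - Real.tanh (π * t / 2) * I) := by
  set s : ℂ := 1 / 2 + t * I with hs_def
  set τ : ℝ := Real.tanh (π * t / 2) with hτ_def
  set k : ℝ := Real.sqrt 2 / 2 * Real.cosh (π * t / 2) with hk_def
  have hk : 0 < k := sqrt_two_div_two_mul_cosh_pos t
  have hconj : conj (s + 1) = 2 - s := by
    apply Complex.ext
    · simp [hs_def]; norm_num
    · simp [hs_def]
  have hsin : Complex.sin (π * s / 2) = (k : ℂ) * (1 + τ * I) := sin_pi_mul_half_critical t
  have h1τ : (1 : ℂ) + τ * I ≠ 0 := by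
    intro h; have := congrArg Complex.re h; simp at this
  refine ⟨1 / (k * (1 + τ ^ 2)), by positivity, ?_⟩
  rw [← Gammaℝ_conj, hconj, Gammaℝ_mul_Gammaℝ_two_sub, hsin]
  have hk' : (k : ℂ) ≠ 0 := ofReal_ne_zero.mpr hk.ne'
  have h2 : (1 : ℂ) + τ ^ 2 = (1 + τ * I) * (1 - τ * I) := by
    ring_nf; rw [Complex.I_sq]; ring
  have h1τ2 : (1 : ℂ) + τ ^ 2 ≠ 0 := by
    rw [h2]; refine mul_ne_zero h1τ ?_
    intro h; have := congrArg Complex.re h; simp at this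
  push_cast
  field_simp
  rw [h2]

/-- `1 − tanh x ≤ 2/(1+x)²` for `x ≥ 0` (`1 − tanh x = 2/(e^{2x}+1)` and `e^x ≥ 1 + x`).
[folklore] -/
theorem one_sub_tanh_le {x : ℝ} (hx : 0 ≤ x) : 1 - Real.tanh x ≤ 2 / (1 + x) ^ 2 := by
  have he : 0 < Real.exp x := Real.exp_pos x
  have h1 : 1 - Real.tanh x = 2 / (Real.exp x ^ 2 + 1) := by
    rw [Real.tanh_eq, Real.exp_neg]
    field_simp
    ring
  rw [h1]
  have h2 : (1 + x) ^ 2 ≤ Real.exp x ^ 2 + 1 := by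
    have := Real.add_one_le_exp x
    nlinarith
  exact div_le_div_of_nonneg_left (by norm_num) (by positivity) h2

/-- `tanh x ≤ 1`. [folklore] -/
theorem tanh_le_one (x : ℝ) : Real.tanh x ≤ 1 := (Real.tanh_lt_one x).le

/-- `Re(z/w) < 0 ↔ Re(z · conj w) < 0` for `w ≠ 0` (`z/w = z conj w / |w|²`). [folklore] -/
theorem re_div_neg_iff {z w : ℂ} (hw : w ≠ 0) : (z / w).re < 0 ↔ (z * conj w).re < 0 := by
  have hn : 0 < Complex.normSq w := Complex.normSq_pos.2 hw
  have h : z / w = z * conj w * ((Complex.normSq w)⁻¹ : ℝ) := by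
    rw [div_eq_mul_inv, Complex.inv_def, ← mul_assoc]
  rw [h, Complex.re_mul_ofReal]
  constructor
  · intro h'
    by_contra hge; push Not at hge
    have := mul_nonneg hge (inv_nonneg.2 hn.le)
    linarith
  · intro h'
    exact mul_neg_of_neg_of_pos h' (inv_pos.2 hn)

end Literature.Barriers.RiemannHypothesis
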